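import Mathlib.Data.Real.Basic
import Mathlib.Tactic.Ring
import Mathlib.Tactic.Linarith
import Mathlib.Tactic.NormNum
import HarnessLib

/-!
# The u = z CROSS member at a single-pair cylinder: algebraic core of the certificate
# (PAPER-2 track (ii): constants of the CSH family; seat `prim-consts-2`, gen 23)

builds on p205010 (kernel theorem, internal audit signed; external expert review pending).  Support file (`--supports
stmt-CriticalPhenomena-4575`); memo `run/shared/lean/prim/consts/FROM-prim-consts-2-g23-PINNED-BINDING.md` §0(7).  One theorem of real
arithmetic; no definitions, no sorries, standard axioms.

SETTING.  The X = ∅ instance of the u = z CROSS member `M₂` (gen 22: necessary for MDL(X)′; the "atom (L)") is, for an owner `s`, markers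
`y, z` and a monotone functional `F` of the open edge cluster `C_s`,
  `P(s|y|z) · Cov(F(C_s), 1{s~z}) ≥ P(yz|s) · [P(s≁z)·E(F; s~y, s≁z) − E(F; s≁z)·P(s~y, s≁z)]`.
Its GENERIC class (F neither y-pinned nor y-saturated) had no proved member.  For the simplest generic functional — the single-pair
cylinder `F = 1{pair sv open}` (`v ∉ {s, y, z}`) — the inequality, divided by the weight of `sv` (the events `{s,v}~z`, `{s,v}~y` do not
read the pair `sv`), is the following CUBIC inequality in the fifteen connection-pattern probabilities `p_π` of the four points `s, y, z, v`
(pattern = partition of `{s,y,z,v}` into open clusters; `p_syzv`, `p_yzv_s` = `P(yzv|s)`, …, `p_s_y_z_v`):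
  `T_e = a·VZ·1 + b_s·Z̄·p_sy_zv − b_s·Z̄·p_yv_s_z − b_s·b_z·VZ ≥ 0`,
  `a = P(s|y|z)`, `VZ = P(v~z, s≁z)`, `b_s = P(y~z, s≁y)`, `Z̄ = P(s≁z)`, `b_z = P(s~y, s≁z)` (each a sum of pattern probabilities, `1 = Σ_π p_π`).
THIS FILE proves `T_e ≥ 0` from nonnegativity of the `p_π` and FIVE hypotheses, each a known percolation inequality read on pattern
probabilities (their percolation proofs are tree theorems; the event-level instantiation is the companion file to come):
 * `hH1`: Harris for the increasing events `{s~y}` and `{z ~ s ∨ z ~ y ∨ z ~ v}`;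
 * `hH2`: Harris for `{s~y ∨ y~z}` and `{s~z ∨ y~z}`;
 * `hH3`: Harris for `{y~s ∨ (y~v ∧ y~z)}` and `{z ~ s ∨ z ~ y ∨ z ~ v}`;
 * `hAD`: van den Berg–Häggström–Kahn conditional positive association for the cluster of the SET `{y,z}` given `{y,z} ≁ s`
   (Thm 1.2/1.3 with Remark 1; tree `BHK2006_twoSetConditionalAssociation`): `P({y,z}≁s)·P(y~z~v, {y,z}≁s) ≥ P(y~z, {y,z}≁s)·P(y~v, {y,z}≁s)`;
 * `hMDL`: the covariance transfer MDL(X) with owner `z`, avoided set `{s}`, markers `y` and `v`, functional `1{y ∈ C_z ∨ v ∈ C_z}`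
   (tree `CovTau.covTau` / `CovTau.markerDominanceAvoid`), written out on patterns.
The certificate (unit multipliers on `p_yzv_s·H1 + p_sy_zv·H2 + p_zv_s_y·H3 + b_s·AD + MDL`; remainder = 66 monomials with coefficients 1, 2)
was found by LP over g22's generator families (kit j216649, bundle prim-consts-2/g23/kit/lp5) and is verified here by `ring` + `linarith`.
CONTRAST: the vertex functional `1{v ∈ C_s}` is NOT in the same cone (g22, kit j212370 ff.).
[cite: VandenbergHaggstromKahn2005, Thm. 1.2 with Remark 1 (p. 5), Thm. 1.3 (p. 6), §2.1 (pp. 9–13)] [cite: Grimmett1999, §2.2 (Harris–FKG)]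
-/

namespace Summit.CriticalPhenomena.PercolationContinuityZ3.Theorems

namespace Consts.PairCylinder

/-- **Algebraic core of the single-pair-cylinder case of the u = z CROSS member (X = ∅).**  For nonnegative reals `p_π` indexed by
the fifteen connection patterns of `s, y, z, v`, the three Harris inequalities `hH1`–`hH3`, the vdBHK two-set conditional
association `hAD` and the covariance transfer MDL({s}) for the cluster of `z` (`hMDL`), all read on patterns, imply
`a·VZ·(Σp) + b_s·Z̄·p_sy_zv − b_s·Z̄·p_yv_s_z − b_s·b_z·VZ ≥ 0` — the inequality (L) at the functional `1{pair sv open}` divided by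
the weight of `sv`.  Certificate: unit multipliers, nonnegative remainder of 66 monomials.
[cite: VandenbergHaggstromKahn2005, Thm. 1.3 (p. 6), §2.1 (pp. 9–13)] -/
theorem core_nonneg (p_syzv p_yzv_s p_szv_y p_sy_zv p_zv_s_y p_syv_z p_sz_yv p_yv_s_z p_sv_yz p_syz_v p_yz_s_v p_sv_y_z p_sz_y_v p_sy_z_v p_s_y_z_v : ℝ)
    (hp_syzv : 0 ≤ p_syzv)
    (hp_yzv_s : 0 ≤ p_yzv_s)
    (hp_szv_y : 0 ≤ p_szv_y)
    (hp_sy_zv : 0 ≤ p_sy_zv)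
    (hp_zv_s_y : 0 ≤ p_zv_s_y)
    (hp_syv_z : 0 ≤ p_syv_z)
    (hp_sz_yv : 0 ≤ p_sz_yv)
    (hp_yv_s_z : 0 ≤ p_yv_s_z)
    (hp_sv_yz : 0 ≤ p_sv_yz)
    (hp_syz_v : 0 ≤ p_syz_v)
    (hp_yz_s_v : 0 ≤ p_yz_s_v)
    (hp_sv_y_z : 0 ≤ p_sv_y_z)
    (hp_sz_y_v : 0 ≤ p_sz_y_v)
    (hp_sy_z_v : 0 ≤ p_sy_z_v)
    (hp_s_y_z_v : 0 ≤ p_s_y_z_v)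
    (hH1 : 0 ≤ p_syzv * p_yv_s_z + p_syzv * p_sv_y_z + p_syzv * p_s_y_z_v - p_yzv_s * p_syv_z - p_yzv_s * p_sy_z_v - p_szv_y * p_syv_z - p_szv_y * p_sy_z_v
          + p_sy_zv * p_yv_s_z + p_sy_zv * p_sv_y_z + p_sy_zv * p_s_y_z_v - p_zv_s_y * p_syv_z - p_zv_s_y * p_sy_z_v - p_syv_z * p_sz_yv - p_syv_z * p_sv_yz
          - p_syv_z * p_yz_s_v - p_syv_z * p_sz_y_v - p_sz_yv * p_sy_z_v + p_yv_s_z * p_syz_v - p_sv_yz * p_sy_z_v + p_syz_v * p_sv_y_z + p_syz_v * p_s_y_z_v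
          - p_yz_s_v * p_sy_z_v - p_sz_y_v * p_sy_z_v)
    (hH2 : 0 ≤ p_syzv * p_zv_s_y + p_syzv * p_yv_s_z + p_syzv * p_sv_y_z + p_syzv * p_s_y_z_v + p_yzv_s * p_zv_s_y + p_yzv_s * p_yv_s_z + p_yzv_s * p_sv_y_z
          + p_yzv_s * p_s_y_z_v - p_szv_y * p_sy_zv - p_szv_y * p_syv_z - p_szv_y * p_sy_z_v - p_sy_zv * p_sz_yv - p_sy_zv * p_sz_y_v + p_zv_s_y * p_sv_yz
          + p_zv_s_y * p_syz_v + p_zv_s_y * p_yz_s_v - p_syv_z * p_sz_yv - p_syv_z * p_sz_y_v - p_sz_yv * p_sy_z_v + p_yv_s_z * p_sv_yz + p_yv_s_z * p_syz_v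
          + p_yv_s_z * p_yz_s_v + p_sv_yz * p_sv_y_z + p_sv_yz * p_s_y_z_v + p_syz_v * p_sv_y_z + p_syz_v * p_s_y_z_v + p_yz_s_v * p_sv_y_z + p_yz_s_v * p_s_y_z_v
          - p_sz_y_v * p_sy_z_v)
    (hH3 : 0 ≤ p_syzv * p_yv_s_z + p_syzv * p_sv_y_z + p_syzv * p_s_y_z_v + p_yzv_s * p_yv_s_z + p_yzv_s * p_sv_y_z + p_yzv_s * p_s_y_z_v - p_szv_y * p_syv_z
          - p_szv_y * p_sy_z_v + p_sy_zv * p_yv_s_z + p_sy_zv * p_sv_y_z + p_sy_zv * p_s_y_z_v - p_zv_s_y * p_syv_z - p_zv_s_y * p_sy_z_v - p_syv_z * p_sz_yv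
          - p_syv_z * p_sv_yz - p_syv_z * p_yz_s_v - p_syv_z * p_sz_y_v - p_sz_yv * p_sy_z_v + p_yv_s_z * p_syz_v - p_sv_yz * p_sy_z_v + p_syz_v * p_sv_y_z
          + p_syz_v * p_s_y_z_v - p_yz_s_v * p_sy_z_v - p_sz_y_v * p_sy_z_v)
    (hAD : 0 ≤ p_yzv_s * p_zv_s_y + p_yzv_s * p_sv_y_z + p_yzv_s * p_s_y_z_v - p_yv_s_z * p_sv_yz - p_yv_s_z * p_yz_s_v)
    (hMDL : 0 ≤ p_yzv_s * p_szv_y * p_syv_z + p_yzv_s * p_szv_y * p_yv_s_z + p_yzv_s * p_szv_y * p_sv_y_z + p_yzv_s * p_szv_y * p_sy_z_v + p_yzv_s * p_szv_y * p_s_y_z_v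
          + p_yzv_s * p_zv_s_y * p_syv_z + p_yzv_s * p_zv_s_y * p_yv_s_z + p_yzv_s * p_zv_s_y * p_sv_y_z + p_yzv_s * p_zv_s_y * p_sy_z_v + p_yzv_s * p_zv_s_y * p_s_y_z_v
          + p_yzv_s * p_syv_z * p_sv_y_z + p_yzv_s * p_syv_z * p_sz_y_v + p_yzv_s * p_syv_z * p_s_y_z_v + p_yzv_s * p_yv_s_z * p_sv_y_z + p_yzv_s * p_yv_s_z * p_sz_y_v
          + p_yzv_s * p_yv_s_z * p_s_y_z_v + p_yzv_s * p_sv_y_z * p_sv_y_z + p_yzv_s * p_sv_y_z * p_sz_y_v + p_yzv_s * p_sv_y_z * p_sy_z_v + 2 * p_yzv_s * p_sv_y_z * p_s_y_z_v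
          + p_yzv_s * p_sz_y_v * p_sy_z_v + p_yzv_s * p_sz_y_v * p_s_y_z_v + p_yzv_s * p_sy_z_v * p_s_y_z_v + p_yzv_s * p_s_y_z_v * p_s_y_z_v + p_szv_y * p_sy_zv * p_syv_z
          + p_szv_y * p_sy_zv * p_yv_s_z + p_szv_y * p_sy_zv * p_sv_y_z + p_szv_y * p_sy_zv * p_sy_z_v + p_szv_y * p_sy_zv * p_s_y_z_v + p_szv_y * p_zv_s_y * p_syv_z
          + p_szv_y * p_zv_s_y * p_yv_s_z + p_szv_y * p_zv_s_y * p_sv_y_z + p_szv_y * p_zv_s_y * p_sy_z_v + p_szv_y * p_zv_s_y * p_s_y_z_v + p_sy_zv * p_zv_s_y * p_syv_z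
          + p_sy_zv * p_zv_s_y * p_yv_s_z + p_sy_zv * p_zv_s_y * p_sv_y_z + p_sy_zv * p_zv_s_y * p_sy_z_v + p_sy_zv * p_zv_s_y * p_s_y_z_v + p_sy_zv * p_syv_z * p_sz_yv
          + p_sy_zv * p_syv_z * p_yv_s_z + p_sy_zv * p_syv_z * p_sv_y_z + p_sy_zv * p_syv_z * p_sz_y_v + p_sy_zv * p_syv_z * p_s_y_z_v + p_sy_zv * p_sz_yv * p_yv_s_z
          + p_sy_zv * p_sz_yv * p_sv_y_z + p_sy_zv * p_sz_yv * p_sy_z_v + p_sy_zv * p_sz_yv * p_s_y_z_v + p_sy_zv * p_yv_s_z * p_yv_s_z + 2 * p_sy_zv * p_yv_s_z * p_sv_y_z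
          + p_sy_zv * p_yv_s_z * p_sz_y_v + p_sy_zv * p_yv_s_z * p_sy_z_v + 2 * p_sy_zv * p_yv_s_z * p_s_y_z_v + p_sy_zv * p_sv_y_z * p_sv_y_z + p_sy_zv * p_sv_y_z * p_sz_y_v
          + p_sy_zv * p_sv_y_z * p_sy_z_v + 2 * p_sy_zv * p_sv_y_z * p_s_y_z_v + p_sy_zv * p_sz_y_v * p_sy_z_v + p_sy_zv * p_sz_y_v * p_s_y_z_v + p_sy_zv * p_sy_z_v * p_s_y_z_v
          + p_sy_zv * p_s_y_z_v * p_s_y_z_v + p_zv_s_y * p_zv_s_y * p_syv_z + p_zv_s_y * p_zv_s_y * p_yv_s_z + p_zv_s_y * p_zv_s_y * p_sv_y_z + p_zv_s_y * p_zv_s_y * p_sy_z_v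
          + p_zv_s_y * p_zv_s_y * p_s_y_z_v + p_zv_s_y * p_syv_z * p_sz_yv + p_zv_s_y * p_syv_z * p_yv_s_z + p_zv_s_y * p_syv_z * p_sv_y_z + p_zv_s_y * p_syv_z * p_sz_y_v
          + p_zv_s_y * p_syv_z * p_s_y_z_v + p_zv_s_y * p_sz_yv * p_yv_s_z + p_zv_s_y * p_sz_yv * p_sv_y_z + p_zv_s_y * p_sz_yv * p_sy_z_v + p_zv_s_y * p_sz_yv * p_s_y_z_v
          + p_zv_s_y * p_yv_s_z * p_yv_s_z + 2 * p_zv_s_y * p_yv_s_z * p_sv_y_z + p_zv_s_y * p_yv_s_z * p_sz_y_v + p_zv_s_y * p_yv_s_z * p_sy_z_v + 2 * p_zv_s_y * p_yv_s_z * p_s_y_z_v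
          + p_zv_s_y * p_sv_y_z * p_sv_y_z + p_zv_s_y * p_sv_y_z * p_sz_y_v + p_zv_s_y * p_sv_y_z * p_sy_z_v + 2 * p_zv_s_y * p_sv_y_z * p_s_y_z_v + p_zv_s_y * p_sz_y_v * p_sy_z_v
          + p_zv_s_y * p_sz_y_v * p_s_y_z_v + p_zv_s_y * p_sy_z_v * p_s_y_z_v + p_zv_s_y * p_s_y_z_v * p_s_y_z_v - p_syv_z * p_sz_yv * p_sv_yz - p_syv_z * p_sz_yv * p_yz_s_v
          - p_syv_z * p_yv_s_z * p_sv_yz - p_syv_z * p_yv_s_z * p_yz_s_v - p_sz_yv * p_yv_s_z * p_sv_yz - p_sz_yv * p_yv_s_z * p_yz_s_v - p_sz_yv * p_sv_yz * p_sv_y_z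
          - p_sz_yv * p_sv_yz * p_sy_z_v - p_sz_yv * p_sv_yz * p_s_y_z_v - p_sz_yv * p_yz_s_v * p_sv_y_z - p_sz_yv * p_yz_s_v * p_sy_z_v - p_sz_yv * p_yz_s_v * p_s_y_z_v
          - p_yv_s_z * p_yv_s_z * p_sv_yz - p_yv_s_z * p_yv_s_z * p_yz_s_v - p_yv_s_z * p_sv_yz * p_sv_y_z - p_yv_s_z * p_sv_yz * p_sy_z_v - p_yv_s_z * p_sv_yz * p_s_y_z_v
          - p_yv_s_z * p_yz_s_v * p_sv_y_z - p_yv_s_z * p_yz_s_v * p_sy_z_v - p_yv_s_z * p_yz_s_v * p_s_y_z_v) :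
    0 ≤ (p_zv_s_y + p_yv_s_z + p_sv_y_z + p_s_y_z_v) * (p_yzv_s + p_sy_zv + p_zv_s_y) * (p_syzv + p_yzv_s + p_szv_y + p_sy_zv + p_zv_s_y + p_syv_z + p_sz_yv
          + p_yv_s_z + p_sv_yz + p_syz_v + p_yz_s_v + p_sv_y_z + p_sz_y_v + p_sy_z_v + p_s_y_z_v)
        + (p_yzv_s + p_sv_yz + p_yz_s_v) * (p_yzv_s + p_sy_zv + p_zv_s_y + p_syv_z + p_yv_s_z + p_sv_yz + p_yz_s_v + p_sv_y_z + p_sy_z_v + p_s_y_z_v) * p_sy_zv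
        - (p_yzv_s + p_sv_yz + p_yz_s_v) * (p_yzv_s + p_sy_zv + p_zv_s_y + p_syv_z + p_yv_s_z + p_sv_yz + p_yz_s_v + p_sv_y_z + p_sy_z_v + p_s_y_z_v) * p_yv_s_z
        - (p_yzv_s + p_sv_yz + p_yz_s_v) * (p_sy_zv + p_syv_z + p_sy_z_v) * (p_yzv_s + p_sy_zv + p_zv_s_y) := by
  have key : (p_zv_s_y + p_yv_s_z + p_sv_y_z + p_s_y_z_v) * (p_yzv_s + p_sy_zv + p_zv_s_y) * (p_syzv + p_yzv_s + p_szv_y + p_sy_zv + p_zv_s_y + p_syv_z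
        + p_sz_yv + p_yv_s_z + p_sv_yz + p_syz_v + p_yz_s_v + p_sv_y_z + p_sz_y_v + p_sy_z_v + p_s_y_z_v)
        + (p_yzv_s + p_sv_yz + p_yz_s_v) * (p_yzv_s + p_sy_zv + p_zv_s_y + p_syv_z + p_yv_s_z + p_sv_yz + p_yz_s_v + p_sv_y_z + p_sy_z_v + p_s_y_z_v) * p_sy_zv
        - (p_yzv_s + p_sv_yz + p_yz_s_v) * (p_yzv_s + p_sy_zv + p_zv_s_y + p_syv_z + p_yv_s_z + p_sv_yz + p_yz_s_v + p_sv_y_z + p_sy_z_v + p_s_y_z_v) * p_yv_s_z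
        - (p_yzv_s + p_sv_yz + p_yz_s_v) * (p_sy_zv + p_syv_z + p_sy_z_v) * (p_yzv_s + p_sy_zv + p_zv_s_y)
      = p_yzv_s * (p_syzv * p_yv_s_z + p_syzv * p_sv_y_z + p_syzv * p_s_y_z_v - p_yzv_s * p_syv_z - p_yzv_s * p_sy_z_v - p_szv_y * p_syv_z - p_szv_y * p_sy_z_v
            + p_sy_zv * p_yv_s_z + p_sy_zv * p_sv_y_z + p_sy_zv * p_s_y_z_v - p_zv_s_y * p_syv_z - p_zv_s_y * p_sy_z_v - p_syv_z * p_sz_yv - p_syv_z * p_sv_yz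
            - p_syv_z * p_yz_s_v - p_syv_z * p_sz_y_v - p_sz_yv * p_sy_z_v + p_yv_s_z * p_syz_v - p_sv_yz * p_sy_z_v + p_syz_v * p_sv_y_z + p_syz_v * p_s_y_z_v
            - p_yz_s_v * p_sy_z_v - p_sz_y_v * p_sy_z_v)
        + p_sy_zv * (p_syzv * p_zv_s_y + p_syzv * p_yv_s_z + p_syzv * p_sv_y_z + p_syzv * p_s_y_z_v + p_yzv_s * p_zv_s_y + p_yzv_s * p_yv_s_z + p_yzv_s * p_sv_y_z
              + p_yzv_s * p_s_y_z_v - p_szv_y * p_sy_zv - p_szv_y * p_syv_z - p_szv_y * p_sy_z_v - p_sy_zv * p_sz_yv - p_sy_zv * p_sz_y_v + p_zv_s_y * p_sv_yz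
              + p_zv_s_y * p_syz_v + p_zv_s_y * p_yz_s_v - p_syv_z * p_sz_yv - p_syv_z * p_sz_y_v - p_sz_yv * p_sy_z_v + p_yv_s_z * p_sv_yz + p_yv_s_z * p_syz_v
              + p_yv_s_z * p_yz_s_v + p_sv_yz * p_sv_y_z + p_sv_yz * p_s_y_z_v + p_syz_v * p_sv_y_z + p_syz_v * p_s_y_z_v + p_yz_s_v * p_sv_y_z + p_yz_s_v * p_s_y_z_v
              - p_sz_y_v * p_sy_z_v)
        + p_zv_s_y * (p_syzv * p_yv_s_z + p_syzv * p_sv_y_z + p_syzv * p_s_y_z_v + p_yzv_s * p_yv_s_z + p_yzv_s * p_sv_y_z + p_yzv_s * p_s_y_z_v - p_szv_y * p_syv_z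
              - p_szv_y * p_sy_z_v + p_sy_zv * p_yv_s_z + p_sy_zv * p_sv_y_z + p_sy_zv * p_s_y_z_v - p_zv_s_y * p_syv_z - p_zv_s_y * p_sy_z_v - p_syv_z * p_sz_yv
              - p_syv_z * p_sv_yz - p_syv_z * p_yz_s_v - p_syv_z * p_sz_y_v - p_sz_yv * p_sy_z_v + p_yv_s_z * p_syz_v - p_sv_yz * p_sy_z_v + p_syz_v * p_sv_y_z
              + p_syz_v * p_s_y_z_v - p_yz_s_v * p_sy_z_v - p_sz_y_v * p_sy_z_v)
        + (p_yzv_s + p_sv_yz + p_yz_s_v) * (p_yzv_s * p_zv_s_y + p_yzv_s * p_sv_y_z + p_yzv_s * p_s_y_z_v - p_yv_s_z * p_sv_yz - p_yv_s_z * p_yz_s_v)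
        + (p_yzv_s * p_szv_y * p_syv_z + p_yzv_s * p_szv_y * p_yv_s_z + p_yzv_s * p_szv_y * p_sv_y_z + p_yzv_s * p_szv_y * p_sy_z_v + p_yzv_s * p_szv_y * p_s_y_z_v
              + p_yzv_s * p_zv_s_y * p_syv_z + p_yzv_s * p_zv_s_y * p_yv_s_z + p_yzv_s * p_zv_s_y * p_sv_y_z + p_yzv_s * p_zv_s_y * p_sy_z_v + p_yzv_s * p_zv_s_y * p_s_y_z_v
              + p_yzv_s * p_syv_z * p_sv_y_z + p_yzv_s * p_syv_z * p_sz_y_v + p_yzv_s * p_syv_z * p_s_y_z_v + p_yzv_s * p_yv_s_z * p_sv_y_z + p_yzv_s * p_yv_s_z * p_sz_y_v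
              + p_yzv_s * p_yv_s_z * p_s_y_z_v + p_yzv_s * p_sv_y_z * p_sv_y_z + p_yzv_s * p_sv_y_z * p_sz_y_v + p_yzv_s * p_sv_y_z * p_sy_z_v + 2 * p_yzv_s * p_sv_y_z * p_s_y_z_v
              + p_yzv_s * p_sz_y_v * p_sy_z_v + p_yzv_s * p_sz_y_v * p_s_y_z_v + p_yzv_s * p_sy_z_v * p_s_y_z_v + p_yzv_s * p_s_y_z_v * p_s_y_z_v + p_szv_y * p_sy_zv * p_syv_z
              + p_szv_y * p_sy_zv * p_yv_s_z + p_szv_y * p_sy_zv * p_sv_y_z + p_szv_y * p_sy_zv * p_sy_z_v + p_szv_y * p_sy_zv * p_s_y_z_v + p_szv_y * p_zv_s_y * p_syv_z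
              + p_szv_y * p_zv_s_y * p_yv_s_z + p_szv_y * p_zv_s_y * p_sv_y_z + p_szv_y * p_zv_s_y * p_sy_z_v + p_szv_y * p_zv_s_y * p_s_y_z_v + p_sy_zv * p_zv_s_y * p_syv_z
              + p_sy_zv * p_zv_s_y * p_yv_s_z + p_sy_zv * p_zv_s_y * p_sv_y_z + p_sy_zv * p_zv_s_y * p_sy_z_v + p_sy_zv * p_zv_s_y * p_s_y_z_v + p_sy_zv * p_syv_z * p_sz_yv
              + p_sy_zv * p_syv_z * p_yv_s_z + p_sy_zv * p_syv_z * p_sv_y_z + p_sy_zv * p_syv_z * p_sz_y_v + p_sy_zv * p_syv_z * p_s_y_z_v + p_sy_zv * p_sz_yv * p_yv_s_z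
              + p_sy_zv * p_sz_yv * p_sv_y_z + p_sy_zv * p_sz_yv * p_sy_z_v + p_sy_zv * p_sz_yv * p_s_y_z_v + p_sy_zv * p_yv_s_z * p_yv_s_z + 2 * p_sy_zv * p_yv_s_z * p_sv_y_z
              + p_sy_zv * p_yv_s_z * p_sz_y_v + p_sy_zv * p_yv_s_z * p_sy_z_v + 2 * p_sy_zv * p_yv_s_z * p_s_y_z_v + p_sy_zv * p_sv_y_z * p_sv_y_z + p_sy_zv * p_sv_y_z * p_sz_y_v
              + p_sy_zv * p_sv_y_z * p_sy_z_v + 2 * p_sy_zv * p_sv_y_z * p_s_y_z_v + p_sy_zv * p_sz_y_v * p_sy_z_v + p_sy_zv * p_sz_y_v * p_s_y_z_v + p_sy_zv * p_sy_z_v * p_s_y_z_v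
              + p_sy_zv * p_s_y_z_v * p_s_y_z_v + p_zv_s_y * p_zv_s_y * p_syv_z + p_zv_s_y * p_zv_s_y * p_yv_s_z + p_zv_s_y * p_zv_s_y * p_sv_y_z + p_zv_s_y * p_zv_s_y * p_sy_z_v
              + p_zv_s_y * p_zv_s_y * p_s_y_z_v + p_zv_s_y * p_syv_z * p_sz_yv + p_zv_s_y * p_syv_z * p_yv_s_z + p_zv_s_y * p_syv_z * p_sv_y_z + p_zv_s_y * p_syv_z * p_sz_y_v
              + p_zv_s_y * p_syv_z * p_s_y_z_v + p_zv_s_y * p_sz_yv * p_yv_s_z + p_zv_s_y * p_sz_yv * p_sv_y_z + p_zv_s_y * p_sz_yv * p_sy_z_v + p_zv_s_y * p_sz_yv * p_s_y_z_v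
              + p_zv_s_y * p_yv_s_z * p_yv_s_z + 2 * p_zv_s_y * p_yv_s_z * p_sv_y_z + p_zv_s_y * p_yv_s_z * p_sz_y_v + p_zv_s_y * p_yv_s_z * p_sy_z_v
              + 2 * p_zv_s_y * p_yv_s_z * p_s_y_z_v + p_zv_s_y * p_sv_y_z * p_sv_y_z + p_zv_s_y * p_sv_y_z * p_sz_y_v + p_zv_s_y * p_sv_y_z * p_sy_z_v
              + 2 * p_zv_s_y * p_sv_y_z * p_s_y_z_v + p_zv_s_y * p_sz_y_v * p_sy_z_v + p_zv_s_y * p_sz_y_v * p_s_y_z_v + p_zv_s_y * p_sy_z_v * p_s_y_z_v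
              + p_zv_s_y * p_s_y_z_v * p_s_y_z_v - p_syv_z * p_sz_yv * p_sv_yz - p_syv_z * p_sz_yv * p_yz_s_v - p_syv_z * p_yv_s_z * p_sv_yz - p_syv_z * p_yv_s_z * p_yz_s_v
              - p_sz_yv * p_yv_s_z * p_sv_yz - p_sz_yv * p_yv_s_z * p_yz_s_v - p_sz_yv * p_sv_yz * p_sv_y_z - p_sz_yv * p_sv_yz * p_sy_z_v - p_sz_yv * p_sv_yz * p_s_y_z_v
              - p_sz_yv * p_yz_s_v * p_sv_y_z - p_sz_yv * p_yz_s_v * p_sy_z_v - p_sz_yv * p_yz_s_v * p_s_y_z_v - p_yv_s_z * p_yv_s_z * p_sv_yz - p_yv_s_z * p_yv_s_z * p_yz_s_v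
              - p_yv_s_z * p_sv_yz * p_sv_y_z - p_yv_s_z * p_sv_yz * p_sy_z_v - p_yv_s_z * p_sv_yz * p_s_y_z_v - p_yv_s_z * p_yz_s_v * p_sv_y_z - p_yv_s_z * p_yz_s_v * p_sy_z_v
              - p_yv_s_z * p_yz_s_v * p_s_y_z_v)
        + (p_syzv * p_yzv_s * p_zv_s_y + p_syzv * p_zv_s_y * p_zv_s_y + p_yzv_s * p_szv_y * p_zv_s_y + p_yzv_s * p_sy_zv * p_zv_s_y + p_yzv_s * p_sy_zv * p_sv_yz
              + p_yzv_s * p_sy_zv * p_yz_s_v + p_yzv_s * p_sy_zv * p_sv_y_z + p_yzv_s * p_sy_zv * p_s_y_z_v + 2 * p_yzv_s * p_zv_s_y * p_zv_s_y + p_yzv_s * p_zv_s_y * p_sz_yv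
              + p_yzv_s * p_zv_s_y * p_syz_v + p_yzv_s * p_zv_s_y * p_sv_y_z + p_yzv_s * p_zv_s_y * p_sz_y_v + p_yzv_s * p_zv_s_y * p_s_y_z_v + p_yzv_s * p_syv_z * p_sz_yv
              + p_yzv_s * p_sz_yv * p_yv_s_z + p_yzv_s * p_sz_yv * p_sv_y_z + p_yzv_s * p_sz_yv * p_sy_z_v + p_yzv_s * p_sz_yv * p_s_y_z_v + p_szv_y * p_sy_zv * p_sy_zv
              + p_szv_y * p_sy_zv * p_zv_s_y + p_szv_y * p_zv_s_y * p_zv_s_y + p_sy_zv * p_sy_zv * p_zv_s_y + p_sy_zv * p_sy_zv * p_sz_yv + p_sy_zv * p_sy_zv * p_yv_s_z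
              + p_sy_zv * p_sy_zv * p_sv_y_z + p_sy_zv * p_sy_zv * p_sz_y_v + p_sy_zv * p_sy_zv * p_s_y_z_v + 2 * p_sy_zv * p_zv_s_y * p_zv_s_y + p_sy_zv * p_zv_s_y * p_sz_yv
              + p_sy_zv * p_zv_s_y * p_yv_s_z + p_sy_zv * p_zv_s_y * p_sv_y_z + p_sy_zv * p_zv_s_y * p_sz_y_v + p_sy_zv * p_zv_s_y * p_s_y_z_v + p_sy_zv * p_sv_yz * p_sv_yz
              + 2 * p_sy_zv * p_sv_yz * p_yz_s_v + p_sy_zv * p_sv_yz * p_sv_y_z + p_sy_zv * p_sv_yz * p_s_y_z_v + p_sy_zv * p_yz_s_v * p_yz_s_v + p_sy_zv * p_yz_s_v * p_sv_y_z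
              + p_sy_zv * p_yz_s_v * p_s_y_z_v + p_zv_s_y * p_zv_s_y * p_zv_s_y + p_zv_s_y * p_zv_s_y * p_syv_z + p_zv_s_y * p_zv_s_y * p_sz_yv + p_zv_s_y * p_zv_s_y * p_yv_s_z
              + p_zv_s_y * p_zv_s_y * p_sv_yz + p_zv_s_y * p_zv_s_y * p_syz_v + p_zv_s_y * p_zv_s_y * p_yz_s_v + p_zv_s_y * p_zv_s_y * p_sv_y_z + p_zv_s_y * p_zv_s_y * p_sz_y_v
              + p_zv_s_y * p_zv_s_y * p_sy_z_v + p_zv_s_y * p_zv_s_y * p_s_y_z_v + p_zv_s_y * p_sv_yz * p_sv_y_z + p_zv_s_y * p_sv_yz * p_s_y_z_v + p_zv_s_y * p_yz_s_v * p_sv_y_z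
              + p_zv_s_y * p_yz_s_v * p_s_y_z_v + p_syv_z * p_sz_yv * p_sv_yz + p_syv_z * p_sz_yv * p_yz_s_v + p_sz_yv * p_yv_s_z * p_sv_yz + p_sz_yv * p_yv_s_z * p_yz_s_v
              + p_sz_yv * p_sv_yz * p_sv_y_z + p_sz_yv * p_sv_yz * p_sy_z_v + p_sz_yv * p_sv_yz * p_s_y_z_v + p_sz_yv * p_yz_s_v * p_sv_y_z + p_sz_yv * p_yz_s_v * p_sy_z_v
              + p_sz_yv * p_yz_s_v * p_s_y_z_v) := by ring
  have hR : 0 ≤ p_syzv * p_yzv_s * p_zv_s_y + p_syzv * p_zv_s_y * p_zv_s_y + p_yzv_s * p_szv_y * p_zv_s_y + p_yzv_s * p_sy_zv * p_zv_s_y + p_yzv_s * p_sy_zv * p_sv_yz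
        + p_yzv_s * p_sy_zv * p_yz_s_v + p_yzv_s * p_sy_zv * p_sv_y_z + p_yzv_s * p_sy_zv * p_s_y_z_v + 2 * p_yzv_s * p_zv_s_y * p_zv_s_y + p_yzv_s * p_zv_s_y * p_sz_yv
        + p_yzv_s * p_zv_s_y * p_syz_v + p_yzv_s * p_zv_s_y * p_sv_y_z + p_yzv_s * p_zv_s_y * p_sz_y_v + p_yzv_s * p_zv_s_y * p_s_y_z_v + p_yzv_s * p_syv_z * p_sz_yv
        + p_yzv_s * p_sz_yv * p_yv_s_z + p_yzv_s * p_sz_yv * p_sv_y_z + p_yzv_s * p_sz_yv * p_sy_z_v + p_yzv_s * p_sz_yv * p_s_y_z_v + p_szv_y * p_sy_zv * p_sy_zv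
        + p_szv_y * p_sy_zv * p_zv_s_y + p_szv_y * p_zv_s_y * p_zv_s_y + p_sy_zv * p_sy_zv * p_zv_s_y + p_sy_zv * p_sy_zv * p_sz_yv + p_sy_zv * p_sy_zv * p_yv_s_z
        + p_sy_zv * p_sy_zv * p_sv_y_z + p_sy_zv * p_sy_zv * p_sz_y_v + p_sy_zv * p_sy_zv * p_s_y_z_v + 2 * p_sy_zv * p_zv_s_y * p_zv_s_y + p_sy_zv * p_zv_s_y * p_sz_yv
        + p_sy_zv * p_zv_s_y * p_yv_s_z + p_sy_zv * p_zv_s_y * p_sv_y_z + p_sy_zv * p_zv_s_y * p_sz_y_v + p_sy_zv * p_zv_s_y * p_s_y_z_v + p_sy_zv * p_sv_yz * p_sv_yz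
        + 2 * p_sy_zv * p_sv_yz * p_yz_s_v + p_sy_zv * p_sv_yz * p_sv_y_z + p_sy_zv * p_sv_yz * p_s_y_z_v + p_sy_zv * p_yz_s_v * p_yz_s_v + p_sy_zv * p_yz_s_v * p_sv_y_z
        + p_sy_zv * p_yz_s_v * p_s_y_z_v + p_zv_s_y * p_zv_s_y * p_zv_s_y + p_zv_s_y * p_zv_s_y * p_syv_z + p_zv_s_y * p_zv_s_y * p_sz_yv + p_zv_s_y * p_zv_s_y * p_yv_s_z
        + p_zv_s_y * p_zv_s_y * p_sv_yz + p_zv_s_y * p_zv_s_y * p_syz_v + p_zv_s_y * p_zv_s_y * p_yz_s_v + p_zv_s_y * p_zv_s_y * p_sv_y_z + p_zv_s_y * p_zv_s_y * p_sz_y_v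
        + p_zv_s_y * p_zv_s_y * p_sy_z_v + p_zv_s_y * p_zv_s_y * p_s_y_z_v + p_zv_s_y * p_sv_yz * p_sv_y_z + p_zv_s_y * p_sv_yz * p_s_y_z_v + p_zv_s_y * p_yz_s_v * p_sv_y_z
        + p_zv_s_y * p_yz_s_v * p_s_y_z_v + p_syv_z * p_sz_yv * p_sv_yz + p_syv_z * p_sz_yv * p_yz_s_v + p_sz_yv * p_yv_s_z * p_sv_yz + p_sz_yv * p_yv_s_z * p_yz_s_v
        + p_sz_yv * p_sv_yz * p_sv_y_z + p_sz_yv * p_sv_yz * p_sy_z_v + p_sz_yv * p_sv_yz * p_s_y_z_v + p_sz_yv * p_yz_s_v * p_sv_y_z + p_sz_yv * p_yz_s_v * p_sy_z_v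
        + p_sz_yv * p_yz_s_v * p_s_y_z_v :=
    add_nonneg (add_nonneg (add_nonneg (add_nonneg (add_nonneg (add_nonneg (add_nonneg (add_nonneg (add_nonneg (add_nonneg (add_nonneg (add_nonneg (add_nonneg (add_nonneg (add_nonneg (add_nonneg (add_nonneg (add_nonneg (add_nonneg (add_nonneg (add_nonneg (add_nonneg (add_nonneg (add_nonneg (add_nonneg (add_nonneg (add_nonneg (add_nonneg (add_nonneg (add_nonneg (add_nonneg (add_nonneg (add_nonneg (add_nonneg (add_nonneg (add_nonneg (add_nonneg (add_nonneg (add_nonneg (add_nonneg (add_nonneg (add_nonneg (add_nonneg (add_nonneg (add_nonneg (add_nonneg (add_nonneg (add_nonneg (add_nonneg (add_nonneg (add_nonneg (add_nonneg (add_nonneg (add_nonneg (add_nonneg (add_nonneg (add_nonneg (add_nonneg (add_nonneg (add_nonneg (add_nonneg (add_nonneg (add_nonneg (add_nonneg (add_nonneg (mul_nonneg (mul_nonneg hp_syzv hp_yzv_s) hp_zv_s_y) (mul_nonneg (mul_nonneg hp_syzv hp_zv_s_y) hp_zv_s_y)) (mul_nonneg (mul_nonneg hp_yzv_s hp_szv_y)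 hp_zv_s_y)) (mul_nonneg (mul_nonneg hp_yzv_s hp_sy_zv) hp_zv_s_y)) (mul_nonneg (mul_nonneg hp_yzv_s hp_sy_zv) hp_sv_yz)) (mul_nonneg (mul_nonneg hp_yzv_s hp_sy_zv) hp_yz_s_v)) (mul_nonneg (mul_nonneg hp_yzv_s hp_sy_zv) hp_sv_y_z)) (mul_nonneg (mul_nonneg hp_yzv_s hp_sy_zv) hp_s_y_z_v)) (mul_nonneg (mul_nonneg (mul_nonneg (by norm_num) hp_yzv_s) hp_zv_s_y) hp_zv_s_y)) (mul_nonneg (mul_nonneg hp_yzv_s hp_zv_s_y) hp_sz_yv)) (mul_nonneg (mul_nonneg hp_yzv_s hp_zv_s_y) hp_syz_v)) (mul_nonneg (mul_nonneg hp_yzv_s hp_zv_s_y) hp_sv_y_z)) (mul_nonneg (mul_nonneg hp_yzv_s hp_zv_s_y) hp_sz_y_v)) (mul_nonneg (mul_nonneg hp_yzv_s hp_zv_s_y) hp_s_y_z_v)) (mul_nonneg (mul_nonneg hp_yzv_s hp_syv_z) hp_sz_yv)) (mul_nonneg (mul_nonneg hp_yzv_s hp_sz_yv) hp_yv_s_z))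 (mul_nonneg (mul_nonneg hp_yzv_s hp_sz_yv) hp_sv_y_z)) (mul_nonneg (mul_nonneg hp_yzv_s hp_sz_yv) hp_sy_z_v)) (mul_nonneg (mul_nonneg hp_yzv_s hp_sz_yv) hp_s_y_z_v)) (mul_nonneg (mul_nonneg hp_szv_y hp_sy_zv) hp_sy_zv)) (mul_nonneg (mul_nonneg hp_szv_y hp_sy_zv) hp_zv_s_y)) (mul_nonneg (mul_nonneg hp_szv_y hp_zv_s_y) hp_zv_s_y)) (mul_nonneg (mul_nonneg hp_sy_zv hp_sy_zv) hp_zv_s_y)) (mul_nonneg (mul_nonneg hp_sy_zv hp_sy_zv) hp_sz_yv)) (mul_nonneg (mul_nonneg hp_sy_zv hp_sy_zv) hp_yv_s_z)) (mul_nonneg (mul_nonneg hp_sy_zv hp_sy_zv) hp_sv_y_z)) (mul_nonneg (mul_nonneg hp_sy_zv hp_sy_zv) hp_sz_y_v)) (mul_nonneg (mul_nonneg hp_sy_zv hp_sy_zv) hp_s_y_z_v)) (mul_nonneg (mul_nonneg (mul_nonneg (by norm_num) hp_sy_zv) hp_zv_s_y) hp_zv_s_y)) (mul_nonneg (mul_nonneg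 hp_sy_zv hp_zv_s_y) hp_sz_yv)) (mul_nonneg (mul_nonneg hp_sy_zv hp_zv_s_y) hp_yv_s_z)) (mul_nonneg (mul_nonneg hp_sy_zv hp_zv_s_y) hp_sv_y_z)) (mul_nonneg (mul_nonneg hp_sy_zv hp_zv_s_y) hp_sz_y_v)) (mul_nonneg (mul_nonneg hp_sy_zv hp_zv_s_y) hp_s_y_z_v)) (mul_nonneg (mul_nonneg hp_sy_zv hp_sv_yz) hp_sv_yz)) (mul_nonneg (mul_nonneg (mul_nonneg (by norm_num) hp_sy_zv) hp_sv_yz) hp_yz_s_v)) (mul_nonneg (mul_nonneg hp_sy_zv hp_sv_yz) hp_sv_y_z)) (mul_nonneg (mul_nonneg hp_sy_zv hp_sv_yz) hp_s_y_z_v)) (mul_nonneg (mul_nonneg hp_sy_zv hp_yz_s_v) hp_yz_s_v)) (mul_nonneg (mul_nonneg hp_sy_zv hp_yz_s_v) hp_sv_y_z)) (mul_nonneg (mul_nonneg hp_sy_zv hp_yz_s_v) hp_s_y_z_v)) (mul_nonneg (mul_nonneg hp_zv_s_y hp_zv_s_y) hp_zv_s_y)) (mul_nonneg (mul_nonneg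 hp_zv_s_y hp_zv_s_y) hp_syv_z)) (mul_nonneg (mul_nonneg hp_zv_s_y hp_zv_s_y) hp_sz_yv)) (mul_nonneg (mul_nonneg hp_zv_s_y hp_zv_s_y) hp_yv_s_z)) (mul_nonneg (mul_nonneg hp_zv_s_y hp_zv_s_y) hp_sv_yz)) (mul_nonneg (mul_nonneg hp_zv_s_y hp_zv_s_y) hp_syz_v)) (mul_nonneg (mul_nonneg hp_zv_s_y hp_zv_s_y) hp_yz_s_v)) (mul_nonneg (mul_nonneg hp_zv_s_y hp_zv_s_y) hp_sv_y_z)) (mul_nonneg (mul_nonneg hp_zv_s_y hp_zv_s_y) hp_sz_y_v)) (mul_nonneg (mul_nonneg hp_zv_s_y hp_zv_s_y) hp_sy_z_v)) (mul_nonneg (mul_nonneg hp_zv_s_y hp_zv_s_y) hp_s_y_z_v)) (mul_nonneg (mul_nonneg hp_zv_s_y hp_sv_yz) hp_sv_y_z)) (mul_nonneg (mul_nonneg hp_zv_s_y hp_sv_yz) hp_s_y_z_v)) (mul_nonneg (mul_nonneg hp_zv_s_y hp_yz_s_v) hp_sv_y_z)) (mul_nonneg (mul_nonneg hp_zv_s_y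 hp_yz_s_v) hp_s_y_z_v)) (mul_nonneg (mul_nonneg hp_syv_z hp_sz_yv) hp_sv_yz)) (mul_nonneg (mul_nonneg hp_syv_z hp_sz_yv) hp_yz_s_v)) (mul_nonneg (mul_nonneg hp_sz_yv hp_yv_s_z) hp_sv_yz)) (mul_nonneg (mul_nonneg hp_sz_yv hp_yv_s_z) hp_yz_s_v)) (mul_nonneg (mul_nonneg hp_sz_yv hp_sv_yz) hp_sv_y_z)) (mul_nonneg (mul_nonneg hp_sz_yv hp_sv_yz) hp_sy_z_v)) (mul_nonneg (mul_nonneg hp_sz_yv hp_sv_yz) hp_s_y_z_v)) (mul_nonneg (mul_nonneg hp_sz_yv hp_yz_s_v) hp_sv_y_z)) (mul_nonneg (mul_nonneg hp_sz_yv hp_yz_s_v) hp_sy_z_v)) (mul_nonneg (mul_nonneg hp_sz_yv hp_yz_s_v) hp_s_y_z_v)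
  have h1 := mul_nonneg hp_yzv_s hH1
  have h2 := mul_nonneg hp_sy_zv hH2
  have h3 := mul_nonneg hp_zv_s_y hH3
  have h4 := mul_nonneg (add_nonneg (add_nonneg (hp_yzv_s) hp_sv_yz) hp_yz_s_v) hAD
  rw [key]
  linarith [h1, h2, h3, h4, hMDL, hR]

end Consts.PairCylinder

end Summit.CriticalPhenomena.PercolationContinuityZ3.Theorems
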